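import Summits.HubbardSuperconductivity.HubbardSuperconductivity.Theorems.DeformationLadderLowEnergyRigidityTelescopeRigidityGlue
import Summits.HubbardSuperconductivity.HubbardSuperconductivity.Theorems.TwistGapTgCondensationOfRigidity

/-!
# Telescope rigidity, part 5: the telescope's two inputs at a point give both D1 children at that point

Route `DeformationLadder`, crux `LowEnergyRigidity` (item stmt-HubbardSuperconductivity-1892), line
`Sketch` (poincare-telescope). Support file (`--supports stmt-HubbardSuperconductivity-1892`).

`d1ChildrenAt_of_josephson_of_floor`: at a point `(U, δ)`, the two open inputs of the registered
skeleton `Cruxes/LowEnergyRigidity/Lines/Sketch.lean` — the Josephson family (`stub_josephson` class,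
some `J > 0`, `C`, `ℓ₁ > 0`) and the coherence floor (`stub_floor` class, one floor `r₀ > 0` on an
unbounded set of lattice scales) — imply AT THE SAME POINT the bodies of BOTH cruxes of route
TwistGap's D1 split: pair-momentum rigidity (item stmt-HubbardSuperconductivity-1509 at `(U, δ)`, by
part 3 `pairMomentumRigidity_of_josephsonInequalityAt`) and infrared condensation of the low-energy
window (item stmt-HubbardSuperconductivity-1510 at `(U, δ)`, by the landed reduction `stub_reduction`
— the pointwise body of the crux — and `TwistGap.lro_le_windowSum` with window `K = 0`, `θ = a`,
`Γ = κ`). Conversely the two D1 bodies at a point give the crux (part 4,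
`lowEnergyRigidity_of_rigidityAt_of_condensationAt`). So, pointwise, the telescope decomposition
REFINES the D1 decomposition. CONDITIONAL throughout (all four inputs are conjecture-grade); nothing is
claimed about them. No definitions. [folklore]
-/

noncomputable section

namespace Summit.HubbardSuperconductivity.HubbardSuperconductivity.Theorems.LowEnergyRigidity.Telescope

set_option linter.dupNamespace false -- summit = problem name (single-conjunct summit), D-0017

open Matrix Literature.MathematicalPhysics.QuantumLattice Literature.Probability.LatticeModels
open Summit.HubbardSuperconductivity.HubbardSuperconductivity.Theses.DeformationLadder
open Summit.HubbardSuperconductivity.HubbardSuperconductivity.Theorems.TwistGap (lro_le_windowSum)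

/-- **The telescope's inputs at a point give both D1 children at that point.** For every `(U, δ)`:
the Josephson family (some `J > 0`, `C`, `ℓ₁ > 0`) and the coherence floor (one `r₀ > 0` on an
unbounded set of scales `ℓ₀`) imply (i) the body of `TwistGap.TgPairMomentumRigidity` at `(U, δ)` and
(ii) the body of `TwistGap.TgLowEnergyCondensation` at `(U, δ)` (with window `K = 0`).
CONDITIONAL (inputs conjecture-grade). [folklore] -/
theorem d1ChildrenAt_of_josephson_of_floor :
    ∀ (U δ : ℝ),
    (∃ J : ℝ, 0 < J ∧ ∃ C : ℝ, ∃ ℓ₁ : ℕ, 0 < ℓ₁ ∧ JosephsonInequalityAt U δ J C ℓ₁) →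
    (∃ r₀ : ℝ, 0 < r₀ ∧ ∀ n : ℕ, ∃ ℓ₀ : ℕ, n ≤ ℓ₀ ∧ CoherenceFloorAt U δ r₀ ℓ₀) →
    (∀ (K : ℕ) (σ : ℝ), 0 < σ → ∃ γ : ℝ, 0 < γ ∧ ∃ L₀ : ℕ, ∀ (L : ℕ) [NeZero L], L₀ ≤ L → Even L →
      ∀ φ : Fock (Orb (FermionTorus 2 L)),
        φ ∈ (szSector (Λ := FermionTorus 2 L) (2 * ⌊(1 - δ) * (L : ℝ) ^ 2 / 2⌋₊) 0) → star φ ⬝ᵥ φ = 1 →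
        γ * ((∑ k ∈ (Finset.univ.filter (fun k : TorusSite 2 L => k ≠ 0 ∧ ∀ i : Fin 2, min (k i).val (L - (k i).val) ≤ K)),
            (expect (Matrix.conjTranspose (∑ x : TorusSite 2 L, Complex.exp (-(2 * (Real.pi : ℂ) * Complex.I / (L : ℂ)) *
                ((∑ i : Fin 2, (k i).val * (x i).val : ℕ) : ℂ)) • localPair dWaveFormFactor L x) *
              (∑ x : TorusSite 2 L, Complex.exp (-(2 * (Real.pi : ℂ) * Complex.I / (L : ℂ)) *
                ((∑ i : Fin 2, (k i).val * (x i).val : ℕ) : ℂ)) • localPair dWaveFormFactor L x)) φ).re / (L : ℝ) ^ 4) - σ) ≤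
          (expect (hubbardTorus 2 L 1 U) φ).re -
            (hubbardTorus 2 L 1 U).minEnergyOn (szSector (Λ := FermionTorus 2 L) (2 * ⌊(1 - δ) * (L : ℝ) ^ 2 / 2⌋₊) 0)) ∧
    (∃ K : ℕ, ∃ θ : ℝ, 0 < θ ∧ ∃ Γ : ℝ, 0 < Γ ∧ ∃ L₀ : ℕ, ∀ (L : ℕ) [NeZero L], L₀ ≤ L → Even L →
      ∀ φ : Fock (Orb (FermionTorus 2 L)),
        φ ∈ (szSector (Λ := FermionTorus 2 L) (2 * ⌊(1 - δ) * (L : ℝ) ^ 2 / 2⌋₊) 0) → star φ ⬝ᵥ φ = 1 →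
        (expect (hubbardTorus 2 L 1 U) φ).re ≤
          (hubbardTorus 2 L 1 U).minEnergyOn (szSector (Λ := FermionTorus 2 L) (2 * ⌊(1 - δ) * (L : ℝ) ^ 2 / 2⌋₊) 0) + Γ →
        θ ≤ (∑ k ∈ (Finset.univ.filter (fun k : TorusSite 2 L => ∀ i : Fin 2, min (k i).val (L - (k i).val) ≤ K)),
            (expect (Matrix.conjTranspose (∑ x : TorusSite 2 L, Complex.exp (-(2 * (Real.pi : ℂ) * Complex.I / (L : ℂ)) *
                ((∑ i : Fin 2, (k i).val * (x i).val : ℕ) : ℂ)) • localPair dWaveFormFactor L x) *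
              (∑ x : TorusSite 2 L, Complex.exp (-(2 * (Real.pi : ℂ) * Complex.I / (L : ℂ)) *
                ((∑ i : Fin 2, (k i).val * (x i).val : ℕ) : ℂ)) • localPair dWaveFormFactor L x)) φ).re / (L : ℝ) ^ 4)) := by
  intro U δ hJos hFloor
  constructor
  · obtain ⟨J, hJ, C, ℓ₁, -, hJC⟩ := hJos
    exact pairMomentumRigidity_of_josephsonInequalityAt U δ J C ℓ₁ hJ hJC
  · -- the pointwise body of the crux from the landed telescope reduction
    obtain ⟨κ, hκ, a, ha, L₀, h⟩ := stub_reduction U δ hJos hFloor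
    refine ⟨0, a, ha, κ, hκ, L₀, fun L _ hL hev φ hmem hφ1 hE => ?_⟩
    have h1 := h L hL hev φ hmem hφ1 (by unfold expect at hE; exact hE)
    exact h1.trans (lro_le_windowSum L 0 φ)

end Summit.HubbardSuperconductivity.HubbardSuperconductivity.Theorems.LowEnergyRigidity.Telescope
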